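import Mathlib.Analysis.Calculus.ParametricIntegral
import Mathlib.Analysis.Calculus.ContDiff.FTaylorSeries
import Mathlib.Analysis.Calculus.ContDiff.Defs
import Mathlib.MeasureTheory.Integral.Bochner.ContinuousLinearMap
import HarnessLib

/-!
# Smooth dependence on parameters of dominated integrals (all orders)

Analysis/FunctionSpaces support file: differentiation under the integral sign **to all
orders**. Mathlib (at the pin of this tree) has one derivative under the integral sign
(`hasFDerivAt_integral_of_dominated_of_fderiv_le`), and the tree's
`SmoothParametricIntegral.lean` has the `C^∞` statement for integrals of smooth functions over a
*compact interval* (domination from compactness). This file proves the `C^∞` statement for a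
general measure under **local domination of every derivative**: if `f : P → Y → G` is smooth in
the parameter `p ∈ U` (`U` open) for a.e. `y`, its parameter derivatives
`y ↦ D^m_p f(p, y)` are measurable, and for every order `m` and every `p₀ ∈ U` there are
`ε > 0` and an integrable `g` with `‖D^m_p f(p, y)‖ ≤ g(y)` for a.e. `y` and all
`p ∈ B(p₀, ε)`, then `p ↦ ∫ f(p, y) dμ(y)` is `C^∞` on `U` and
`D^m ∫ f(p, y) dμ = ∫ D^m_p f(p, y) dμ` (`contDiffOn_integral_of_dominated`,
`iteratedFDeriv_integral_of_dominated`), with the bound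
`‖D^m ∫ f(p, y) dμ‖ ≤ ∫ ‖D^m_p f(p, y)‖ dμ` (`norm_iteratedFDeriv_integral_le_of_dominated`).
This is the form in which heat- and Oseen-kernel potentials of bounded data are shown to be
jointly smooth in `(t, x)` (Evans, *PDE*, §2.3.1, Thm. 1; Folland, *Introduction to PDE*,
Thm. (4.3) and the remark following it: "we can differentiate under the integral as often as we
please").

Proof: with `D_m(p) = ∫ D^m_p f(p, ·)`, one derivative under the integral sign
(domination of `D^{m+1}`) gives `HasFDerivAt D_m (∫ fderiv (D^m_p f(·, y)) p) p`; by induction on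
`m`, `iteratedFDeriv m (∫ f) = D_m` on `U` (`iteratedFDeriv_succ_eq_comp_left`, currying
commutes with the Bochner integral); hence all `iteratedFDerivWithin U` are differentiable on
`U`, which is `C^∞` (`contDiffOn_of_continuousOn_differentiableOn`).

## References

* L. C. Evans, *Partial Differential Equations*, 2nd ed. (2010), §2.3.1 Thm. 1 and App. C.
* G. B. Folland, *Introduction to Partial Differential Equations*, 2nd ed. (1995), Thm. (4.3).
* L. Hörmander, *The Analysis of Linear Partial Differential Operators I* (1990), Thm. 1.1.7–1.1.9.
-/

noncomputable section

open MeasureTheory Set Filter Topology Metric Function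
open scoped ContDiff

namespace Literature.Analysis.FunctionSpaces

variable {P : Type*} [NormedAddCommGroup P] [NormedSpace ℝ P]
  {Y : Type*} [MeasurableSpace Y] {μ : Measure Y}
  {G : Type*} [NormedAddCommGroup G] [NormedSpace ℝ G]
  {U : Set P} {f : P → Y → G}

/-- **Integrability of the parameter derivatives** under local domination. [folklore] -/
theorem integrable_iteratedFDeriv_of_dominated
    (hmeas : ∀ m : ℕ, ∀ p ∈ U, AEStronglyMeasurable (fun y => iteratedFDeriv ℝ m (fun q => f q y) p) μ)
    (hdom : ∀ m : ℕ, ∀ p₀ ∈ U, ∃ ε > 0, ∃ g : Y → ℝ, Integrable g μ ∧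
      ∀ᵐ y ∂μ, ∀ p ∈ ball p₀ ε, ‖iteratedFDeriv ℝ m (fun q => f q y) p‖ ≤ g y)
    (m : ℕ) {p : P} (hp : p ∈ U) :
    Integrable (fun y => iteratedFDeriv ℝ m (fun q => f q y) p) μ := by
  obtain ⟨ε, hε, g, hg, hgb⟩ := hdom m p hp
  exact hg.mono' (hmeas m p hp) (hgb.mono fun y hy => hy p (mem_ball_self hε))

/-- **One derivative of the `m`-th derivative potential under the integral sign**: with
`D_m(p) = ∫ D^m_p f(p, y) dμ`, `HasFDerivAt D_m (∫ fderiv (D^m_p f(·, y)) p₀ dμ) p₀` for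
`p₀ ∈ U` (Mathlib's `hasFDerivAt_integral_of_dominated_of_fderiv_le`, the dominating function
being that of `D^{m+1}`). [folklore] -/
theorem hasFDerivAt_integral_iteratedFDeriv_of_dominated (hU : IsOpen U)
    (hf : ∀ᵐ y ∂μ, ContDiffOn ℝ ∞ (fun p => f p y) U)
    (hmeas : ∀ m : ℕ, ∀ p ∈ U, AEStronglyMeasurable (fun y => iteratedFDeriv ℝ m (fun q => f q y) p) μ)
    (hdom : ∀ m : ℕ, ∀ p₀ ∈ U, ∃ ε > 0, ∃ g : Y → ℝ, Integrable g μ ∧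
      ∀ᵐ y ∂μ, ∀ p ∈ ball p₀ ε, ‖iteratedFDeriv ℝ m (fun q => f q y) p‖ ≤ g y)
    (m : ℕ) {p₀ : P} (hp₀ : p₀ ∈ U) :
    HasFDerivAt (fun p => ∫ y, iteratedFDeriv ℝ m (fun q => f q y) p ∂μ)
      (∫ y, fderiv ℝ (iteratedFDeriv ℝ m (fun q => f q y)) p₀ ∂μ) p₀ := by
  obtain ⟨ε₁, hε₁, g, hg, hgb⟩ := hdom (m + 1) p₀ hp₀
  obtain ⟨ε₂, hε₂, hball⟩ := Metric.isOpen_iff.1 hU p₀ hp₀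
  set ε : ℝ := min ε₁ ε₂ with hε
  have hε0 : 0 < ε := lt_min hε₁ hε₂
  have hsub₁ : ball p₀ ε ⊆ ball p₀ ε₁ := ball_subset_ball (min_le_left _ _)
  have hsub₂ : ball p₀ ε ⊆ U := (ball_subset_ball (min_le_right _ _)).trans hball
  refine hasFDerivAt_integral_of_dominated_of_fderiv_le
    (F := fun p y => iteratedFDeriv ℝ m (fun q => f q y) p)
    (F' := fun p y => fderiv ℝ (iteratedFDeriv ℝ m (fun q => f q y)) p)
    (bound := g) (ball_mem_nhds p₀ hε0) ?_ ?_ ?_ ?_ hg ?_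
  · exact eventually_of_mem (hU.mem_nhds hp₀) fun p hp => hmeas m p hp
  · exact integrable_iteratedFDeriv_of_dominated hmeas hdom m hp₀
  · have heq : (fun y => fderiv ℝ (iteratedFDeriv ℝ m (fun q => f q y)) p₀) = fun y =>
        (continuousMultilinearCurryLeftEquiv ℝ (fun _ : Fin (m + 1) => P) G)
          (iteratedFDeriv ℝ (m + 1) (fun q => f q y) p₀) := by
      funext y
      rw [fderiv_iteratedFDeriv]
      rfl
    rw [heq]
    exact (continuousMultilinearCurryLeftEquiv ℝ (fun _ : Fin (m + 1) => P) G).continuous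
      |>.comp_aestronglyMeasurable (hmeas (m + 1) p₀ hp₀)
  · filter_upwards [hgb] with y hy p hp
    rw [norm_fderiv_iteratedFDeriv]
    exact hy p (hsub₁ hp)
  · filter_upwards [hf] with y hy p hp
    have hd : DifferentiableOn ℝ (iteratedFDeriv ℝ m (fun q => f q y)) U :=
      (hy.differentiableOn_iteratedFDerivWithin (m := m) (by exact_mod_cast ENat.coe_lt_top m)
        hU.uniqueDiffOn).congr fun x hx => (iteratedFDerivWithin_of_isOpen m hU hx).symm
    exact ((hd p (hsub₂ hp)).differentiableAt (hU.mem_nhds (hsub₂ hp))).hasFDerivAt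

/-- **Derivatives of all orders under the integral sign**: under the hypotheses of
`hasFDerivAt_integral_iteratedFDeriv_of_dominated`, for every `m` and `p ∈ U`,
`D^m (∫ f(·, y) dμ) (p) = ∫ D^m_p f(p, y) dμ` (induction on `m`: `iteratedFDeriv_succ_eq_comp_left`
and currying through the Bochner integral). [folklore] -/
theorem iteratedFDeriv_integral_of_dominated (hU : IsOpen U)
    (hf : ∀ᵐ y ∂μ, ContDiffOn ℝ ∞ (fun p => f p y) U)
    (hmeas : ∀ m : ℕ, ∀ p ∈ U, AEStronglyMeasurable (fun y => iteratedFDeriv ℝ m (fun q => f q y) p) μ)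
    (hdom : ∀ m : ℕ, ∀ p₀ ∈ U, ∃ ε > 0, ∃ g : Y → ℝ, Integrable g μ ∧
      ∀ᵐ y ∂μ, ∀ p ∈ ball p₀ ε, ‖iteratedFDeriv ℝ m (fun q => f q y) p‖ ≤ g y)
    (m : ℕ) {p : P} (hp : p ∈ U) :
    iteratedFDeriv ℝ m (fun q => ∫ y, f q y ∂μ) p = ∫ y, iteratedFDeriv ℝ m (fun q => f q y) p ∂μ := by
  induction m generalizing p with
  | zero =>
    simp only [iteratedFDeriv_zero_eq_comp, comp_apply]
    exact (ContinuousLinearEquiv.integral_comp_comm (𝕜 := ℝ) (μ := μ)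
      (continuousMultilinearCurryFin0 ℝ P G).symm.toContinuousLinearEquiv (fun y => f p y)).symm
  | succ m ih =>
    -- `D^m (∫ f) = D_m` near `p`
    have hloc : iteratedFDeriv ℝ m (fun q => ∫ y, f q y ∂μ) =ᶠ[𝓝 p]
        fun q => ∫ y, iteratedFDeriv ℝ m (fun q => f q y) q ∂μ :=
      eventually_of_mem (hU.mem_nhds hp) fun q hq => ih hq
    have hD := (hasFDerivAt_integral_iteratedFDeriv_of_dominated hU hf hmeas hdom m hp).fderiv
    have hcomm := ContinuousLinearEquiv.integral_comp_comm (𝕜 := ℝ) (μ := μ)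
      (continuousMultilinearCurryLeftEquiv ℝ (fun _ : Fin (m + 1) => P) G).symm.toContinuousLinearEquiv
      (fun y => fderiv ℝ (iteratedFDeriv ℝ m fun q => f q y) p)
    rw [iteratedFDeriv_succ_eq_comp_left, comp_apply, hloc.fderiv_eq, hD]
    exact hcomm.symm

/-- **`C^∞` under the integral sign with local domination of every derivative.** If, for a.e.
`y`, `p ↦ f(p, y)` is `C^∞` on the open set `U`, the parameter derivatives are measurable in
`y`, and every `D^m_p f` is locally dominated near every point of `U` by an integrable function,
then `p ↦ ∫ f(p, y) dμ` is `C^∞` on `U` (Evans, App. C; Folland, Thm. (4.3) and the following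
remark). [folklore] -/
theorem contDiffOn_integral_of_dominated (hU : IsOpen U)
    (hf : ∀ᵐ y ∂μ, ContDiffOn ℝ ∞ (fun p => f p y) U)
    (hmeas : ∀ m : ℕ, ∀ p ∈ U, AEStronglyMeasurable (fun y => iteratedFDeriv ℝ m (fun q => f q y) p) μ)
    (hdom : ∀ m : ℕ, ∀ p₀ ∈ U, ∃ ε > 0, ∃ g : Y → ℝ, Integrable g μ ∧
      ∀ᵐ y ∂μ, ∀ p ∈ ball p₀ ε, ‖iteratedFDeriv ℝ m (fun q => f q y) p‖ ≤ g y) :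
    ContDiffOn ℝ ∞ (fun q => ∫ y, f q y ∂μ) U := by
  have hdiff : ∀ m : ℕ, DifferentiableOn ℝ
      (iteratedFDerivWithin ℝ m (fun q => ∫ y, f q y ∂μ) U) U := by
    intro m p hp
    have h1 : (iteratedFDerivWithin ℝ m (fun q => ∫ y, f q y ∂μ) U) =ᶠ[𝓝 p]
        fun q => ∫ y, iteratedFDeriv ℝ m (fun q => f q y) q ∂μ := by
      refine eventually_of_mem (hU.mem_nhds hp) fun q hq => ?_
      rw [iteratedFDerivWithin_of_isOpen m hU hq]
      exact iteratedFDeriv_integral_of_dominated hU hf hmeas hdom m hq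
    exact ((hasFDerivAt_integral_iteratedFDeriv_of_dominated hU hf hmeas hdom m hp).differentiableAt.congr_of_eventuallyEq
      h1).differentiableWithinAt
  refine contDiffOn_of_continuousOn_differentiableOn (n := (⊤ : ℕ∞)) (fun m _ => ?_) (fun m _ => hdiff m)
  exact (hdiff m).continuousOn

/-- **The bound**: `‖D^m ∫ f(·, y) dμ (p)‖ ≤ ∫ ‖D^m_p f(p, y)‖ dμ` for `p ∈ U`. [folklore] -/
theorem norm_iteratedFDeriv_integral_le_of_dominated (hU : IsOpen U)
    (hf : ∀ᵐ y ∂μ, ContDiffOn ℝ ∞ (fun p => f p y) U)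
    (hmeas : ∀ m : ℕ, ∀ p ∈ U, AEStronglyMeasurable (fun y => iteratedFDeriv ℝ m (fun q => f q y) p) μ)
    (hdom : ∀ m : ℕ, ∀ p₀ ∈ U, ∃ ε > 0, ∃ g : Y → ℝ, Integrable g μ ∧
      ∀ᵐ y ∂μ, ∀ p ∈ ball p₀ ε, ‖iteratedFDeriv ℝ m (fun q => f q y) p‖ ≤ g y)
    (m : ℕ) {p : P} (hp : p ∈ U) :
    ‖iteratedFDeriv ℝ m (fun q => ∫ y, f q y ∂μ) p‖ ≤
      ∫ y, ‖iteratedFDeriv ℝ m (fun q => f q y) p‖ ∂μ := by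
  rw [iteratedFDeriv_integral_of_dominated hU hf hmeas hdom m hp]
  exact norm_integral_le_integral_norm _

/-- **The bound by the dominating function**: if `‖D^m_p f(p, y)‖ ≤ g(y)` a.e., then
`‖D^m ∫ f(·, y) dμ (p)‖ ≤ ∫ g dμ`. [folklore] -/
theorem norm_iteratedFDeriv_integral_le_of_le (hU : IsOpen U)
    (hf : ∀ᵐ y ∂μ, ContDiffOn ℝ ∞ (fun p => f p y) U)
    (hmeas : ∀ m : ℕ, ∀ p ∈ U, AEStronglyMeasurable (fun y => iteratedFDeriv ℝ m (fun q => f q y) p) μ)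
    (hdom : ∀ m : ℕ, ∀ p₀ ∈ U, ∃ ε > 0, ∃ g : Y → ℝ, Integrable g μ ∧
      ∀ᵐ y ∂μ, ∀ p ∈ ball p₀ ε, ‖iteratedFDeriv ℝ m (fun q => f q y) p‖ ≤ g y)
    (m : ℕ) {p : P} (hp : p ∈ U) {g : Y → ℝ} (hg : Integrable g μ)
    (hle : ∀ᵐ y ∂μ, ‖iteratedFDeriv ℝ m (fun q => f q y) p‖ ≤ g y) :
    ‖iteratedFDeriv ℝ m (fun q => ∫ y, f q y ∂μ) p‖ ≤ ∫ y, g y ∂μ :=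
  (norm_iteratedFDeriv_integral_le_of_dominated hU hf hmeas hdom m hp).trans
    (integral_mono_of_nonneg (Eventually.of_forall fun _ => norm_nonneg _) hg hle)

end Literature.Analysis.FunctionSpaces

end
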